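import Mathlib
import Summits.ValiantsHypothesis.ValiantsHypothesis.Theorems.LacunarySymmetroidMatrixDescartesCensusTwistedRolle
import Summits.ValiantsHypothesis.ValiantsHypothesis.Theorems.LacunarySymmetroidMatrixDescartesCensusFullAlternation
import Summits.ValiantsHypothesis.ValiantsHypothesis.Theorems.LacunarySymmetroidMatrixDescartesCensusWindowFourInterlacing

/-!
# `MatrixDescartes` census — the WINDOW-4 ROW of a Descartes-sharp fewnomial (all supports, all quadruples)

HONEST FRAMING.  Object-search cell `pub-symmetroid`, door-A target `DoorA26 := PosRootLawAt 2 6 19`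
(stmt-ValiantsHypothesis-19979; OPEN, typed, never asserted).  Companion of `…CensusWindowFourInterlacing` (the 4-nomial
interlacing rule) in the interface of `…CensusNewtonCone.newton_cone`: for a real fewnomial `f = ∑_{t<n} cₜ X^{eₜ}` with
strictly increasing exponents and at least `n − 1` distinct positive roots, and ANY quadruple of indices `p < q < r < s`,
kill the other `n − 4` exponents by Euler twists (`card_posRoots_le_card_posRoots_twists`, each killed index `u` multiplies
`cₜ` by `eₜ − e_u`): the killed coefficients `γₜ = cₜ·∏_{u ∉ {p,q,r,s}} (eₜ − e_u)` carry a 4-nomial with three positive roots,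
hence (`fourNomial_interlacing_of_three_posRoots`) with `a = |γ_p|, b = |γ_q|, c = |γ_r|, d = |γ_s|` and gaps
`u = e_q − e_p, v = e_r − e_q, w = e_s − e_r`:

  ∃ 0 < s₁ < s₂,  u·b − (u+v)·c·sᵢ^v + (u+v+w)·d·sᵢ^(v+w) = 0 (i = 1,2),
                  (u+v+w)·a − (v+w)·b·s₁^u + w·c·s₁^(u+v) < 0 < (u+v+w)·a − (v+w)·b·s₂^u + w·c·s₂^(u+v)

(`window_four_rule`).  This is the root-side row beyond the Newton cone that the V = 20 certificates lack (door-p1 g8's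
barrier cells satisfy every `newton_cone` row and violate this one on 14 of their 18 consecutive windows); its band form
(door-p2 g7, THINK-g7.md §7 FACTS 2–3) is paper.  Nothing here bounds any census count; `DoorA26` OPEN; nothing on
`MatrixDescartes` (stmt-ValiantsHypothesis-18050) or `VP ≠ VNP`.

[folklore] Euler-twist (Rolle) descent + Descartes; elementary.
-/

-- `Summit.ValiantsHypothesis.ValiantsHypothesis.…` repeats a component by the D-0017 layout
-- (single-conjunct summit), which the `dupNamespace` linter flags; the name is mandated.
set_option linter.dupNamespace false

namespace Summit.ValiantsHypothesis.ValiantsHypothesis.Theorems.LacunarySymmetroidMatrixDescartes.Census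

open Polynomial Finset Set
open scoped BigOperators Polynomial

/-- Coefficients of the generic 4-nomial `C γ₀ + C γ₁ X^u + C γ₂ X^(u+v) + C γ₃ X^(u+v+w)` (`u,v,w ≥ 1`). [folklore] -/
theorem coeff_fourNomial (γ₀ γ₁ γ₂ γ₃ : ℝ) (u v w : ℕ) (m : ℕ) :
    (C γ₀ + C γ₁ * X ^ u + C γ₂ * X ^ (u + v) + C γ₃ * X ^ (u + v + w) : ℝ[X]).coeff m
      = (if m = 0 then γ₀ else 0) + (if m = u then γ₁ else 0) + (if m = u + v then γ₂ else 0)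
        + (if m = u + v + w then γ₃ else 0) := by
  simp only [coeff_add, coeff_C, coeff_C_mul, coeff_X_pow]
  split_ifs <;> ring

/-- **WINDOW-4 ROW.**  See the module docstring. [folklore] -/
theorem window_four_rule {n : ℕ} (e : Fin n → ℕ) (he : StrictMono e) (c : Fin n → ℝ)
    (hZ : n ≤ ((∑ t, C (c t) * X ^ (e t)).roots.toFinset.filter (fun x => 0 < x)).card + 1)
    {p q r s : Fin n} (hpq : p < q) (hqr : q < r) (hrs : r < s) :
    ∃ s₁ s₂ : ℝ, 0 < s₁ ∧ s₁ < s₂ ∧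
      ((e q - e p : ℕ) : ℝ) * |c q * ∏ x ∈ (((univ.erase p).erase q).erase r).erase s, ((e q : ℝ) - e x)|
        - (((e q - e p : ℕ) : ℝ) + ((e r - e q : ℕ) : ℝ))
            * |c r * ∏ x ∈ (((univ.erase p).erase q).erase r).erase s, ((e r : ℝ) - e x)| * s₁ ^ (e r - e q)
        + (((e q - e p : ℕ) : ℝ) + ((e r - e q : ℕ) : ℝ) + ((e s - e r : ℕ) : ℝ))
            * |c s * ∏ x ∈ (((univ.erase p).erase q).erase r).erase s, ((e s : ℝ) - e x)|
            * s₁ ^ ((e r - e q) + (e s - e r)) = 0 ∧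
      ((e q - e p : ℕ) : ℝ) * |c q * ∏ x ∈ (((univ.erase p).erase q).erase r).erase s, ((e q : ℝ) - e x)|
        - (((e q - e p : ℕ) : ℝ) + ((e r - e q : ℕ) : ℝ))
            * |c r * ∏ x ∈ (((univ.erase p).erase q).erase r).erase s, ((e r : ℝ) - e x)| * s₂ ^ (e r - e q)
        + (((e q - e p : ℕ) : ℝ) + ((e r - e q : ℕ) : ℝ) + ((e s - e r : ℕ) : ℝ))
            * |c s * ∏ x ∈ (((univ.erase p).erase q).erase r).erase s, ((e s : ℝ) - e x)|
            * s₂ ^ ((e r - e q) + (e s - e r)) = 0 ∧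
      (((e q - e p : ℕ) : ℝ) + ((e r - e q : ℕ) : ℝ) + ((e s - e r : ℕ) : ℝ))
            * |c p * ∏ x ∈ (((univ.erase p).erase q).erase r).erase s, ((e p : ℝ) - e x)|
        - (((e r - e q : ℕ) : ℝ) + ((e s - e r : ℕ) : ℝ))
            * |c q * ∏ x ∈ (((univ.erase p).erase q).erase r).erase s, ((e q : ℝ) - e x)| * s₁ ^ (e q - e p)
        + ((e s - e r : ℕ) : ℝ) * |c r * ∏ x ∈ (((univ.erase p).erase q).erase r).erase s, ((e r : ℝ) - e x)|
            * s₁ ^ ((e q - e p) + (e r - e q)) < 0 ∧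
      0 < (((e q - e p : ℕ) : ℝ) + ((e r - e q : ℕ) : ℝ) + ((e s - e r : ℕ) : ℝ))
            * |c p * ∏ x ∈ (((univ.erase p).erase q).erase r).erase s, ((e p : ℝ) - e x)|
        - (((e r - e q : ℕ) : ℝ) + ((e s - e r : ℕ) : ℝ))
            * |c q * ∏ x ∈ (((univ.erase p).erase q).erase r).erase s, ((e q : ℝ) - e x)| * s₂ ^ (e q - e p)
        + ((e s - e r : ℕ) : ℝ) * |c r * ∏ x ∈ (((univ.erase p).erase q).erase r).erase s, ((e r : ℝ) - e x)|
            * s₂ ^ ((e q - e p) + (e r - e q)) := by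
  have hpr : p < r := hpq.trans hqr
  have hps : p < s := hpr.trans hrs
  have hqs : q < s := hqr.trans hrs
  have hepq : e p < e q := he hpq
  have heqr : e q < e r := he hqr
  have hers : e r < e s := he hrs
  -- gaps
  obtain ⟨u, hu⟩ : ∃ u, e q = e p + u := ⟨e q - e p, by omega⟩
  obtain ⟨v, hv⟩ : ∃ v, e r = e q + v := ⟨e r - e q, by omega⟩
  obtain ⟨w, hw⟩ : ∃ w, e s = e r + w := ⟨e s - e r, by omega⟩
  have hu0 : 0 < u := by omega
  have hv0 : 0 < v := by omega
  have hw0 : 0 < w := by omega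
  rw [show e q - e p = u by omega, show e r - e q = v by omega, show e s - e r = w by omega]
  -- the killed index set
  set U : Finset (Fin n) := (((univ.erase p).erase q).erase r).erase s with hU
  have hmemU : ∀ t, t ∈ U ↔ (t ≠ p ∧ t ≠ q ∧ t ≠ r ∧ t ≠ s) := by
    intro t; simp only [hU, Finset.mem_erase, Finset.mem_univ, and_true]; tauto
  have hcardU : U.card + 4 = n := by
    have m1 : p ∈ (univ : Finset (Fin n)) := Finset.mem_univ _
    have m2 : q ∈ univ.erase p := by simp [hpq.ne']
    have m3 : r ∈ (univ.erase p).erase q := by simp [hqr.ne', hpr.ne']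
    have m4 : s ∈ ((univ.erase p).erase q).erase r := by simp [hrs.ne', hqs.ne', hps.ne']
    have h4 : 4 ≤ n := by
      have := s.isLt; have := Fin.lt_def.mp hpq; have := Fin.lt_def.mp hqr; have := Fin.lt_def.mp hrs; omega
    rw [hU, Finset.card_erase_of_mem m4, Finset.card_erase_of_mem m3, Finset.card_erase_of_mem m2,
      Finset.card_erase_of_mem m1, Finset.card_univ, Fintype.card_fin]
    omega
  -- killed coefficients
  set γ : Fin n → ℝ := fun t => c t * ∏ x ∈ U, ((e t : ℝ) - e x) with hγ
  have h1 := card_posRoots_le_card_posRoots_twists e c U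
  have hzero : ∀ t ∈ U, γ t = 0 := fun t ht => by
    simp only [hγ]; rw [Finset.prod_eq_zero ht (sub_self _), mul_zero]
  -- the killed fewnomial is `X^(e p) · h` with the 4-nomial `h`
  set h : ℝ[X] := C (γ p) + C (γ q) * X ^ u + C (γ r) * X ^ (u + v) + C (γ s) * X ^ (u + v + w) with hh
  have hquad0 : (∑ t, C (c t * ∏ x ∈ U, ((e t : ℝ) - e x)) * X ^ (e t))
      = C (γ p) * X ^ (e p) + C (γ q) * X ^ (e q) + C (γ r) * X ^ (e r) + C (γ s) * X ^ (e s) := by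
    have : (∑ t, C (c t * ∏ x ∈ U, ((e t : ℝ) - e x)) * X ^ (e t)) = ∑ t, C (γ t) * X ^ (e t) := by
      simp only [hγ]
    rw [this, ← Finset.sum_subset (Finset.subset_univ ({p, q, r, s} : Finset (Fin n)))]
    · have n1 : p ∉ ({q, r, s} : Finset (Fin n)) := by
        simp only [Finset.mem_insert, Finset.mem_singleton, not_or]; exact ⟨hpq.ne, hpr.ne, hps.ne⟩
      have n2 : q ∉ ({r, s} : Finset (Fin n)) := by
        simp only [Finset.mem_insert, Finset.mem_singleton, not_or]; exact ⟨hqr.ne, hqs.ne⟩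
      have n3 : r ∉ ({s} : Finset (Fin n)) := by
        simp only [Finset.mem_singleton]; exact hrs.ne
      rw [Finset.sum_insert n1, Finset.sum_insert n2, Finset.sum_insert n3, Finset.sum_singleton]
      ring
    · intro t _ ht
      have htU : t ∈ U := (hmemU t).mpr (by simpa [not_or] using ht)
      rw [hzero t htU, map_zero, zero_mul]
  have hquad : (∑ t, C (c t * ∏ x ∈ U, ((e t : ℝ) - e x)) * X ^ (e t)) = C 1 * X ^ (e p) * h := by
    rw [hquad0, hh, hw, hv, hu, map_one, one_mul]
    simp only [pow_add]
    ring
  -- stripping `C 1 * X^(e p)` keeps the positive roots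
  have hstrip : ((C (1:ℝ) * X ^ (e p) * h).roots.toFinset.filter (fun x => 0 < x)).card
      = (h.roots.toFinset.filter (fun x => 0 < x)).card := by
    by_cases hh0 : h = 0
    · rw [hh0, mul_zero]
    have hX : (X ^ (e p) : ℝ[X]) ≠ 0 := pow_ne_zero _ X_ne_zero
    have hCX : (C (1:ℝ) * X ^ (e p) : ℝ[X]) ≠ 0 := mul_ne_zero (C_ne_zero.mpr one_ne_zero) hX
    have h0 : (C (1:ℝ) * X ^ (e p) * h : ℝ[X]) ≠ 0 := mul_ne_zero hCX hh0
    congr 1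
    ext x
    simp only [Finset.mem_filter, Multiset.mem_toFinset, mem_roots h0, mem_roots hh0, IsRoot.def, eval_mul, eval_C,
      eval_pow, eval_X, mul_eq_zero, one_mul]
    constructor
    · rintro ⟨hx0 | hx0, hx⟩
      · exact absurd (pow_eq_zero_iff'.mp hx0).1 hx.ne'
      · exact ⟨hx0, hx⟩
    · rintro ⟨hx0, hx⟩
      exact ⟨Or.inr hx0, hx⟩
  have h3 : 3 ≤ (h.roots.toFinset.filter (fun x => 0 < x)).card := by
    rw [← hstrip, ← hquad]
    omega
  -- every killed coefficient is non-zero (else `h` has ≤ 3 monomials and ≤ 2 positive roots)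
  have hcoef : ∀ m, h.coeff m = (if m = 0 then γ p else 0) + (if m = u then γ q else 0)
      + (if m = u + v then γ r else 0) + (if m = u + v + w then γ s else 0) := fun m => by
    rw [hh]; exact coeff_fourNomial _ _ _ _ u v w m
  have hne : γ p ≠ 0 ∧ γ q ≠ 0 ∧ γ r ≠ 0 ∧ γ s ≠ 0 := by
    have key : ∀ (x y z : ℝ) (k l m : ℕ), h = C x * X ^ k + C y * X ^ l + C z * X ^ m → False := by
      intro x y z k l m hxyz
      have h0 : h ≠ 0 := by intro h0; rw [h0] at h3; simp at h3
      have := card_posRoots_trinomial_le_two k l m x y z (hxyz ▸ h0)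
      rw [← hxyz] at this
      omega
    refine ⟨fun h0 => ?_, fun h0 => ?_, fun h0 => ?_, fun h0 => ?_⟩
    · exact key (γ q) (γ r) (γ s) u (u + v) (u + v + w) (by rw [hh, h0, map_zero, zero_add])
    · exact key (γ p) (γ r) (γ s) 0 (u + v) (u + v + w) (by rw [hh, h0, map_zero, zero_mul, add_zero, pow_zero, mul_one])
    · exact key (γ p) (γ q) (γ s) 0 u (u + v + w) (by rw [hh, h0, map_zero, zero_mul, add_zero, pow_zero, mul_one])
    · exact key (γ p) (γ q) (γ r) 0 u (u + v) (by rw [hh, h0, map_zero, zero_mul, add_zero, pow_zero, mul_one])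
  obtain ⟨hγp, hγq, hγr, hγs⟩ := hne
  -- support of `h` and the alternation of its consecutive coefficients (F1)
  have hsupp : ∀ m, m ∈ h.support ↔ (m = 0 ∨ m = u ∨ m = u + v ∨ m = u + v + w) := by
    intro m
    rw [mem_support_iff, hcoef]
    constructor
    · intro hm
      by_contra hnot
      simp only [not_or] at hnot
      obtain ⟨h0', hu', huv', huvw'⟩ := hnot
      rw [if_neg h0', if_neg hu', if_neg huv', if_neg huvw'] at hm
      simp at hm
    · intro hm
      rcases hm with hm | hm | hm | hm <;> rw [hm]
      · rw [if_pos rfl, if_neg (by omega), if_neg (by omega), if_neg (by omega)]; simpa using hγp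
      · rw [if_neg (by omega), if_pos rfl, if_neg (by omega), if_neg (by omega)]; simpa using hγq
      · rw [if_neg (by omega), if_neg (by omega), if_pos rfl, if_neg (by omega)]; simpa using hγr
      · rw [if_neg (by omega), if_neg (by omega), if_neg (by omega), if_pos rfl]; simpa using hγs
  have hcard4 : h.support.card ≤ (h.roots.toFinset.filter (fun x => 0 < x)).card + 1 := by
    have : h.support ⊆ ({0, u, u + v, u + v + w} : Finset ℕ) := by
      intro m hm; simpa [Finset.mem_insert, Finset.mem_singleton] using (hsupp m).1 hm
    have := (Finset.card_le_card this).trans (Finset.card_le_four)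
    omega
  have hc0 : h.coeff 0 = γ p := by
    rw [hcoef, if_pos rfl, if_neg (by omega), if_neg (by omega), if_neg (by omega)]; ring
  have hcu : h.coeff u = γ q := by
    rw [hcoef, if_neg (by omega), if_pos rfl, if_neg (by omega), if_neg (by omega)]; ring
  have hcuv : h.coeff (u + v) = γ r := by
    rw [hcoef, if_neg (by omega), if_neg (by omega), if_pos rfl, if_neg (by omega)]; ring
  have hcuvw : h.coeff (u + v + w) = γ s := by
    rw [hcoef, if_neg (by omega), if_neg (by omega), if_neg (by omega), if_pos rfl]; ring
  have alt1 : γ p * γ q < 0 := by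
    rw [← hc0, ← hcu]
    exact coeff_mul_coeff_neg_of_sharp h hcard4 ((hsupp 0).2 (Or.inl rfl)) ((hsupp u).2 (Or.inr (Or.inl rfl)))
      hu0 (fun m hm hm' => by rcases (hsupp m).1 hm with rfl | rfl | rfl | rfl <;> omega)
  have alt2 : γ q * γ r < 0 := by
    rw [← hcu, ← hcuv]
    exact coeff_mul_coeff_neg_of_sharp h hcard4 ((hsupp u).2 (Or.inr (Or.inl rfl)))
      ((hsupp (u + v)).2 (Or.inr (Or.inr (Or.inl rfl)))) (by omega)
      (fun m hm hm' => by rcases (hsupp m).1 hm with rfl | rfl | rfl | rfl <;> omega)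
  have alt3 : γ r * γ s < 0 := by
    rw [← hcuv, ← hcuvw]
    exact coeff_mul_coeff_neg_of_sharp h hcard4 ((hsupp (u + v)).2 (Or.inr (Or.inr (Or.inl rfl))))
      ((hsupp (u + v + w)).2 (Or.inr (Or.inr (Or.inr rfl)))) (by omega)
      (fun m hm hm' => by rcases (hsupp m).1 hm with rfl | rfl | rfl | rfl <;> omega)
  -- normalise the global sign: `g₄ = |γ p| − |γ q| X^u + |γ r| X^(u+v) − |γ s| X^(u+v+w)` has the positive roots of `h`
  set g₄ : ℝ[X] := C |γ p| - C |γ q| * X ^ u + C |γ r| * X ^ (u + v) - C |γ s| * X ^ (u + v + w) with hg₄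
  have hroots : (g₄.roots.toFinset.filter (fun x => 0 < x)).card = (h.roots.toFinset.filter (fun x => 0 < x)).card := by
    rcases lt_or_gt_of_ne hγp with hp0 | hp0
    · -- γ p < 0: γ q > 0, γ r < 0, γ s > 0 and g₄ = -h
      have hq0 : 0 < γ q := by nlinarith
      have hr0 : γ r < 0 := by nlinarith
      have hs0 : 0 < γ s := by nlinarith
      have : g₄ = -h := by
        rw [hg₄, hh, abs_of_neg hp0, abs_of_pos hq0, abs_of_neg hr0, abs_of_pos hs0]
        simp only [map_neg]; ring
      rw [this, roots_neg]
    · have hq0 : γ q < 0 := by nlinarith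
      have hr0 : 0 < γ r := by nlinarith
      have hs0 : γ s < 0 := by nlinarith
      have : g₄ = h := by
        rw [hg₄, hh, abs_of_pos hp0, abs_of_neg hq0, abs_of_pos hr0, abs_of_neg hs0]
        simp only [map_neg]; ring
      rw [this]
  have h3' : 3 ≤ (g₄.roots.toFinset.filter (fun x => 0 < x)).card := by rw [hroots]; exact h3
  obtain ⟨s₁, s₂, hs₁, hs₁₂, e1, e2, n1, p2⟩ :=
    fourNomial_interlacing_of_three_posRoots hu0 hv0 hw0 (abs_pos.mpr hγp) (abs_pos.mpr hγq) h3'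
  refine ⟨s₁, s₂, hs₁, hs₁₂, ?_, ?_, ?_, ?_⟩
  · simpa [hγ] using e1
  · simpa [hγ] using e2
  · simpa [hγ] using n1
  · simpa [hγ] using p2

end Summit.ValiantsHypothesis.ValiantsHypothesis.Theorems.LacunarySymmetroidMatrixDescartes.Census
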